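import Mathlib
import Summits.AtomisticToContinuum.HydrodynamicLimit.Theorems.InformationPercolationEngineKickFairRelEquilibriumMesoConditionThePastDefs
import Summits.AtomisticToContinuum.HydrodynamicLimit.Theorems.InformationPercolationEngineKickFairRelEquilibriumMesoShortFlightRung0
import Summits.AtomisticToContinuum.HydrodynamicLimit.Theorems.InformationPercolationEngineKickFairRelEquilibriumMesoCutCount
import Literature.MathematicalPhysics.KineticTheory.EvenStatTruncationBound
import HarnessLib

/-!
# `KickFairRelEquilibriumMeso`, line `condition-the-past` — sub-goal `countExcessLG_const`:
# CT-a (the `LG`-mean EXCESS of the per-sphere collision counts over `A (N+1)^{1/3}`) at RUNG 0,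
# and the exact reduction CT-a ⇐ U for general profiles

Prover file (`--supports stmt-AtomisticToContinuum-15177`) of the lead of the checked skeleton
`Cruxes/KickFairRelEquilibriumMeso/Lines/condition_the_past.lean` (rev 2, lead c7) for the registered sub-goal
`countExcessLG_const` — the statement `CountExcessLG` (CT-a, `…MesoConditionThePastDefs`) at CONSTANT profiles,
i.e. under the homogeneous canonical Gibbs law, which every hard-sphere flow preserves — and for the
machine-checked reduction of the general-profile statement `CountExcessLG` to the `LG`-mean short-flight bound U
(`Holds.stub_shortFlightLG` of the line `Sketch`; hypothesis `hU` of `countExcessLG_of_shortFlightLG`, verbatim).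

The proof is a WINDOWING of `(0, τ]`, pathwise on the good set and law-independent
(`max_cnt_sub_le_sum_shortFlag`): tile `(0, τ]` into `m = ⌈τ / t_N⌉` windows `(w k, w (k+1)]`,
`w k = k τ / m` (`wEnd`), each of length `τ / m ≤ t_N` (`wEnd_succ_le_add_tN`). For `n < cnt_i` the `n`-th
collision time of `i` lies in `(0, τ]` (`nthCollisionTimeOf_mem_Ioc_of_lt_cnt`), hence in exactly one window
(`sum_window_indicator_eq_one`), and its incoming flight (read off the typed past, `.2.2.2 − .2.1`) is either
LONG (`≥ t_N / A`) or SHORT (`< t_N / A`). Per window at most `A + 1` collisions of `i` end a long flight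
(`stub_cutCount`, G1 of the line `Sketch`), so
`cnt_i ≤ m (A + 1) + #short_i(A) ≤ (τ + 1)(A + 1)(N+1)^{1/3} + #short_i(A)`
(`m ≤ τ (N+1)^{1/3} + 1 ≤ (τ + 1)(N+1)^{1/3}`, `natCast_ceil_div_tN_le`), i.e.
`(cnt_i − (τ+1)(A+1)(N+1)^{1/3})₊ ≤ #short_i(A) = Σ_{n < cnt_i} 1{flight_{i,n} < t_N / A}` — the summand of U.
Multiplying by `ε/(N+1)`, summing over `i` and integrating off the null bad set
(`localGibbsLaw_compl_good_eq_zero`, `lintegral_mono_ae`) bounds the CT-a integral at `A' = (τ+1)(A+1)` by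
the U integral at `A`, under ANY local Gibbs law: `countExcessLG_of_shortFlightLG`. At constant profiles U is
the landed first-moment computation `shortFlightLG_rung0` (…MesoShortFlightRung0, p126384), whence
`countExcessLG_const`. (For general continuous profiles U is the open `LG`-native count input of this crux,
`Lines/Sketch-dead.md` §3–§4; nothing here asserts it.)
-/

noncomputable section

open MeasureTheory Set Filter Topology
open scoped ENNReal Classical

namespace Summit.AtomisticToContinuum.HydrodynamicLimit.Theorems.KickFairRelEquilibriumMesoLine

open Literature.Analysis.FluidPDE Literature.MathematicalPhysics.KineticTheory

variable {σ : ℝ} {N : ℕ}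

/-! ## The abstract windowing step -/

/-- **Counting by windows.** If each index `n < c` lies in exactly one of `m` windows
(`Σ_{k<m} W k n = 1`), each index is either long or short (`L n + S n = 1`), and every window carries long
weight at most `B` (`Σ_{n<c} W k n · L n ≤ B`), then `c ≤ m B + Σ_{n<c} S n`. [folklore] -/
theorem natCast_le_mul_add_sum_of_windows {c m : ℕ} {B : ℝ} (W : ℕ → ℕ → ℝ) (L S : ℕ → ℝ)
    (hW : ∀ n < c, ∑ k ∈ Finset.range m, W k n = 1) (hLS : ∀ n, L n + S n = 1)
    (hcut : ∀ k < m, ∑ n ∈ Finset.range c, W k n * L n ≤ B) :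
    (c : ℝ) ≤ (m : ℝ) * B + ∑ n ∈ Finset.range c, S n := by
  have hone : ∀ n ∈ Finset.range c, (∑ k ∈ Finset.range m, W k n) * L n + S n = 1 := fun n hn => by
    rw [hW n (Finset.mem_range.1 hn), one_mul, hLS n]
  have hc : (c : ℝ) = ∑ n ∈ Finset.range c, ((∑ k ∈ Finset.range m, W k n) * L n + S n) := by
    rw [Finset.sum_congr rfl hone, Finset.sum_const, Finset.card_range, nsmul_eq_mul, mul_one]
  rw [hc, Finset.sum_add_distrib]
  refine add_le_add ?_ le_rfl
  calc ∑ n ∈ Finset.range c, (∑ k ∈ Finset.range m, W k n) * L n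
      = ∑ k ∈ Finset.range m, ∑ n ∈ Finset.range c, W k n * L n := by
        simp_rw [Finset.sum_mul]
        exact Finset.sum_comm
    _ ≤ ∑ _k ∈ Finset.range m, B := Finset.sum_le_sum fun k hk => hcut k (Finset.mem_range.1 hk)
    _ = (m : ℝ) * B := by rw [Finset.sum_const, Finset.card_range, nsmul_eq_mul]

/-! ## Kinetic windows tiling `(0, τ]` -/

/-- **The `⌈τ / t_N⌉` windows `(w k, w (k+1)]`, `w k = k τ / ⌈τ / t_N⌉`, have length at most `t_N`.**
[folklore] -/
theorem wEnd_succ_le_add_tN {τ : ℝ} (hτ : 0 < τ) (N k : ℕ) :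
    wEnd τ ⌈τ / tN N⌉₊ (k + 1) ≤ wEnd τ ⌈τ / tN N⌉₊ k + tN N := by
  have htN := tN_pos N
  have hm0 : 0 < ⌈τ / tN N⌉₊ := Nat.ceil_pos.2 (div_pos hτ htN)
  have hmR : (0 : ℝ) < (⌈τ / tN N⌉₊ : ℝ) := by exact_mod_cast hm0
  have hle : τ / tN N ≤ (⌈τ / tN N⌉₊ : ℝ) := Nat.le_ceil _
  have h1 : τ / (⌈τ / tN N⌉₊ : ℝ) ≤ tN N := by
    rw [div_le_iff₀ hmR]
    rw [div_le_iff₀ htN] at hle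
    linarith [mul_comm (⌈τ / tN N⌉₊ : ℝ) (tN N)]
  have h2 : wEnd τ ⌈τ / tN N⌉₊ (k + 1) = wEnd τ ⌈τ / tN N⌉₊ k + τ / (⌈τ / tN N⌉₊ : ℝ) := by
    simp only [wEnd]
    push_cast
    ring
  rw [h2]
  linarith

/-- **The number of windows is at most `(τ + 1)(N+1)^{1/3}`**: `⌈τ / t_N⌉ < τ (N+1)^{1/3} + 1` and
`1 ≤ (N+1)^{1/3}`. [folklore] -/
theorem natCast_ceil_div_tN_le {τ : ℝ} (hτ : 0 ≤ τ) (N : ℕ) :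
    (⌈τ / tN N⌉₊ : ℝ) ≤ (τ + 1) * ((N : ℝ) + 1) ^ (1 / 3 : ℝ) := by
  have hN : (0 : ℝ) < (N : ℝ) + 1 := by positivity
  have hP1 : 1 ≤ ((N : ℝ) + 1) ^ (1 / 3 : ℝ) :=
    Real.one_le_rpow (by linarith [(Nat.cast_nonneg N : (0 : ℝ) ≤ N)]) (by norm_num)
  have htN : τ / tN N = τ * ((N : ℝ) + 1) ^ (1 / 3 : ℝ) := by
    unfold tN
    rw [Real.rpow_neg hN.le, div_inv_eq_mul]
  have hceil : (⌈τ / tN N⌉₊ : ℝ) < τ / tN N + 1 := Nat.ceil_lt_add_one (div_nonneg hτ (tN_pos N).le)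
  rw [htN] at hceil ⊢
  linarith

/-! ## The pathwise excess bound on the good set -/

/-- **Pathwise, on the good set: the excess of the collision count of a sphere over
`(τ+1)(A+1)(N+1)^{1/3}` is at most its number of collisions preceded by a flight shorter than `t_N / A`.**
Window `(0, τ]` into `⌈τ / t_N⌉` windows of length `≤ t_N`; each counted collision time lies in exactly one
window; per window at most `A + 1` collisions end a long flight (`stub_cutCount`); the rest are short.
Law-independent (every mesh `r` of the typed past). [folklore] -/
theorem max_cnt_sub_le_sum_shortFlag (Φ : Flow σ N) {τ : ℝ} (hτ : 0 < τ) (r : ℝ) {A : ℝ} (hA : 0 < A)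
    {z : Phase N} (hz : z ∈ Φ.good) (i : Fin (N + 1)) :
    max ((cnt Φ τ z i : ℝ) - (τ + 1) * (A + 1) * ((N : ℝ) + 1) ^ (1 / 3 : ℝ)) 0 ≤
      ∑ n ∈ Finset.range (cnt Φ τ z i),
        (if (past Φ r z i n).2.2.2 - (past Φ r z i n).2.1 < tN N / A then (1 : ℝ) else 0) := by
  have hm0 : 0 < ⌈τ / tN N⌉₊ := Nat.ceil_pos.2 (div_pos hτ (tN_pos N))
  -- `cnt ≤ m (A + 1) + #short`
  have hcnt : (cnt Φ τ z i : ℝ) ≤ (⌈τ / tN N⌉₊ : ℝ) * (A + 1) + ∑ n ∈ Finset.range (cnt Φ τ z i),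
      (if (past Φ r z i n).2.2.2 - (past Φ r z i n).2.1 < tN N / A then (1 : ℝ) else 0) := by
    refine natCast_le_mul_add_sum_of_windows
      (fun k n => if wEnd τ ⌈τ / tN N⌉₊ k < Φ.nthCollisionTimeOf i n z ∧
          Φ.nthCollisionTimeOf i n z ≤ wEnd τ ⌈τ / tN N⌉₊ (k + 1) then (1 : ℝ) else 0)
      (fun n => if tN N / A ≤ (past Φ r z i n).2.2.2 - (past Φ r z i n).2.1 then (1 : ℝ) else 0)
      (fun n => if (past Φ r z i n).2.2.2 - (past Φ r z i n).2.1 < tN N / A then (1 : ℝ) else 0)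
      (fun n hn => sum_window_indicator_eq_one hτ hm0 (nthCollisionTimeOf_mem_Ioc_of_lt_cnt Φ τ z i hn))
      (fun n => ?_)
      (fun k _ => stub_cutCount σ N Φ τ r A _ _ hA (wEnd_succ_le_add_tN hτ N k) z hz i)
    by_cases h : (past Φ r z i n).2.2.2 - (past Φ r z i n).2.1 < tN N / A
    · simp [h, not_le.2 h]
    · simp [h, not_lt.1 h]
  -- `m (A + 1) ≤ (τ + 1)(A + 1)(N+1)^{1/3}`
  have hwin : (⌈τ / tN N⌉₊ : ℝ) * (A + 1) ≤ (τ + 1) * (A + 1) * ((N : ℝ) + 1) ^ (1 / 3 : ℝ) :=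
    calc (⌈τ / tN N⌉₊ : ℝ) * (A + 1) ≤ (τ + 1) * ((N : ℝ) + 1) ^ (1 / 3 : ℝ) * (A + 1) :=
          mul_le_mul_of_nonneg_right (natCast_ceil_div_tN_le hτ.le N) (by linarith)
      _ = (τ + 1) * (A + 1) * ((N : ℝ) + 1) ^ (1 / 3 : ℝ) := by ring
  refine max_le ?_ (Finset.sum_nonneg fun n _ => by split_ifs <;> norm_num)
  linarith

/-! ## CT-a ⇐ U, exactly (general profiles), and CT-a at rung 0 -/

/-- **The exact reduction CT-a ⇐ U.** If the `LG`-mean of the normalised number of collisions preceded by a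
flight shorter than `t_N / A` is `≤ δ` for `A` large, eventually in `N` (hypothesis `hU`: the registered stub
`Holds.stub_shortFlightLG` of the line `Sketch`, verbatim — the open `LG`-native count input of this crux for
non-constant profiles; NOT asserted here), then `CountExcessLG` holds, with `A' = (τ + 1)(A + 1)` and the same
`σ₀, N₀`: the CT-a integrand is dominated by the U integrand on the good set (`max_cnt_sub_le_sum_shortFlag`),
which carries every local Gibbs law (`localGibbsLaw_compl_good_eq_zero`). [folklore] -/
theorem countExcessLG_of_shortFlightLG
    (hU : ∀ (a₀ θ₀ : T3 → ℝ) (u₀ : T3 → V3), Continuous a₀ → Continuous θ₀ → Continuous u₀ →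
      (∀ x, 0 < a₀ x) → (∀ x, 0 < θ₀ x) →
      ∃ σ₀ : ℝ, 0 < σ₀ ∧ ∀ σ : ℝ, 0 < σ → σ < σ₀ → ∀ Φ : (N : ℕ) → Flow σ N, ∀ τ : ℝ, 0 < τ →
      ∀ δ : ℝ, 0 < δ → ∃ A : ℝ, 0 < A ∧ ∃ N₀ : ℕ, ∀ N : ℕ, N₀ ≤ N →
      ∫⁻ z, ENNReal.ofReal (hsDiameter σ N / ((N : ℝ) + 1) *
          ∑ i : Fin (N + 1), ∑ n ∈ Finset.range (cnt (Φ N) τ z i),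
            (if (past (Φ N) (rs N) z i n).2.2.2 - (past (Φ N) (rs N) z i n).2.1 < tN N / A then (1 : ℝ)
              else 0)) ∂(localGibbsLaw σ a₀ u₀ θ₀ N (Φ N)) ≤ ENNReal.ofReal δ) :
    CountExcessLG := by
  intro a₀ θ₀ u₀ ha hθ hu ha0 hθ0
  obtain ⟨σ₀, hσ₀, H⟩ := hU a₀ θ₀ u₀ ha hθ hu ha0 hθ0
  refine ⟨σ₀, hσ₀, fun σ hσ hσlt Φ τ hτ δ hδ => ?_⟩
  obtain ⟨A, hA, N₀, hN₀⟩ := H σ hσ hσlt Φ τ hτ δ hδ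
  refine ⟨(τ + 1) * (A + 1), by positivity, N₀, fun N hN => le_trans (lintegral_mono_ae ?_) (hN₀ N hN)⟩
  have hc0 : 0 ≤ hsDiameter σ N / ((N : ℝ) + 1) := by
    have := hsDiameter_pos hσ N
    positivity
  have hae : ∀ᵐ z ∂(localGibbsLaw σ a₀ u₀ θ₀ N (Φ N)), z ∈ (Φ N).good := by
    rw [ae_iff]
    exact localGibbsLaw_compl_good_eq_zero (Φ N)
  filter_upwards [hae] with z hz
  exact ENNReal.ofReal_le_ofReal (mul_le_mul_of_nonneg_left
    (Finset.sum_le_sum fun i _ => max_cnt_sub_le_sum_shortFlag (Φ N) hτ (rs N) hA hz i) hc0)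

/-- **Sub-goal `countExcessLG_const` — CT-a at RUNG 0 (constant profiles = the invariant canonical law).**
For constant profiles `a, θ > 0`, `u` there is `σ₀ > 0` such that for every reduced diameter `0 < σ < σ₀`,
every family of hard-sphere flows, horizon `τ > 0` and `δ > 0` there are `A > 0` and `N₀` with: for all
`N ≥ N₀`, `E[(ε/(N+1)) Σ_i (cnt_i − A (N+1)^{1/3})₊] ≤ δ` under the local Gibbs law with constant profiles —
by windowing (`max_cnt_sub_le_sum_shortFlag`, `stub_cutCount`) from the landed rung-0 short-flight mean bound
`shortFlightLG_rung0` (`A := (τ + 1)(A_U + 1)`, same `σ₀`, `N₀`). [folklore] -/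
theorem countExcessLG_const : ∀ (a θ : ℝ) (u : V3), 0 < a → 0 < θ → ∃ σ₀ : ℝ, 0 < σ₀ ∧ ∀ σ : ℝ, 0 < σ → σ < σ₀ → ∀ Φ : (N : ℕ) → Flow σ N, ∀ τ : ℝ, 0 < τ → ∀ δ : ℝ, 0 < δ → ∃ A : ℝ, 0 < A ∧ ∃ N₀ : ℕ, ∀ N : ℕ, N₀ ≤ N → ∫⁻ z, ENNReal.ofReal (hsDiameter σ N / ((N : ℝ) + 1) * ∑ i : Fin (N + 1), max ((cnt (Φ N) τ z i : ℝ) - A * ((N : ℝ) + 1) ^ (1 / 3 : ℝ)) 0) ∂(localGibbsLaw σ (fun _ => a) (fun _ => u) (fun _ => θ) N (Φ N)) ≤ ENNReal.ofReal δ := by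
  intro a θ u ha hθ
  obtain ⟨σ₀, hσ₀, H⟩ := shortFlightLG_rung0 a θ u ha hθ
  refine ⟨σ₀, hσ₀, fun σ hσ hσlt Φ τ hτ δ hδ => ?_⟩
  obtain ⟨A, hA, N₀, hN₀⟩ := H σ hσ hσlt Φ τ hτ δ hδ
  refine ⟨(τ + 1) * (A + 1), by positivity, N₀, fun N hN => le_trans (lintegral_mono_ae ?_) (hN₀ N hN)⟩
  have hc0 : 0 ≤ hsDiameter σ N / ((N : ℝ) + 1) := by
    have := hsDiameter_pos hσ N
    positivity
  have hae : ∀ᵐ z ∂(localGibbsLaw σ (fun _ => a) (fun _ => u) (fun _ => θ) N (Φ N)), z ∈ (Φ N).good := by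
    rw [ae_iff]
    exact localGibbsLaw_compl_good_eq_zero (Φ N)
  filter_upwards [hae] with z hz
  exact ENNReal.ofReal_le_ofReal (mul_le_mul_of_nonneg_left
    (Finset.sum_le_sum fun i _ => max_cnt_sub_le_sum_shortFlag (Φ N) hτ (rs N) hA hz i) hc0)

end Summit.AtomisticToContinuum.HydrodynamicLimit.Theorems.KickFairRelEquilibriumMesoLine

end
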